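import Summits.SmoothPoincare4.SmoothPoincare4.Theorems.ConvexBisectionContractibleTwistedDoubleStandardStubSeam
import Summits.SmoothPoincare4.SmoothPoincare4.Theorems.ContractibleTwistedDoubleStandard.Negative.LoadBearing
import Literature.Geometry.Symplectic.SteinFillingSphere
import Literature.Geometry.Symplectic.SteinFillingSphereMorseReduction
import Literature.Geometry.Symplectic.SteinDomainShrinking
import Literature.Topology.FourManifolds.MorseAffine
import Literature.Topology.FourManifolds.CerfGammaFour
import Literature.Topology.FourManifolds.CerfGammaFourProofs
import Literature.Topology.FourManifolds.TwistedSpheres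
import Literature.Topology.FourManifolds.CorkDecomposition
import Literature.Topology.FourManifolds.ClosedBall
import Mathlib.Geometry.Manifold.Diffeomorph

/-!
# Stub `stub_ballHalf` of line `property-r-mazur-halves` for crux `ConvexBisection.ContractibleTwistedDoubleStandard`
(item stmt-SmoothPoincare4-3546, route route-SmoothPoincare4-ConvexBisection)

The **ball-half sector** of the crux: a closed `4`-manifold `X = e₁(W₁) ∪ e₂(W₂)` covered by two
smoothly embedded compact contractible Stein domains meeting exactly along both boundary images,
with matched complex tangencies, is `S⁴` as soon as the `J`-convex defining function `J₁.φ` of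
the first half is a Morse function with at most one critical point — CONDITIONALLY on the two
named facts of the tree which the skeleton files as separate fact-stubs and feeds in as leading
hypotheses:

* `Literature.Geometry.Symplectic.Eliashberg1990_steinFilling_sphere_three` (Eliashberg 1990,
  Thm. 5.1: a compact Stein domain bounded by `S³` is `𝔻⁴`);
* `Literature.Topology.FourManifolds.cerf_twistedSphere_four` (Cerf 1968, `Γ₄ = 0`: every twisted
  sphere `𝔻⁴ ∪_φ 𝔻⁴` is `S⁴`).

Proof.  (1) `J₁.φ` attains its minimum at some `p` (compact, nonempty since contractible);
`φ p < max φ`, for otherwise `φ` is constant and `dφ = 0` on `∂W₁ = {φ = max φ} ≠ ∅`, against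
the regularity axiom of a Stein structure; so `p` is an interior point, hence a critical point
(Fermat), hence THE critical point.  (2) `g = φ + (1 - max φ)` is a Morse function adapted to the
boundary (`≡ 1` and regular on `∂W₁`, `< 1` inside; Milnor 1965, Def. 3.1) with the single
critical point `p`, an interior local minimum, so `W₁ ≅ 𝔻⁴` by Milnor's disc theorem
(`Literature.Geometry.Symplectic.nonempty_diffeomorph_closedBall_of_isMorseAdapted_of_isLocalMin`,
Milnor 1963, Thm. 3.1 with Lemma 2.2).  (3) The seam map `ψ : ∂W₁ ≅ ∂W₂` of the LANDED stub
`stub_seam` and the boundary restriction `∂Φ₁ : ∂W₁ ≅ S³` show `∂W₂ ≅ S³`, so `W₂ ≅ 𝔻⁴` by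
Eliashberg.  (4) `X` is the boundary gluing `W₁ ∪_ψ W₂` (pieces `e₁`, `e₂`; the seam equations
say that `e₁ a = e₂ a'` exactly when `a = incl₁ z`, `a' = incl₂ (ψ z)`).  (5) Transporting the
gluing along `Φ₁⁻¹ : 𝔻⁴ ≅ W₁` and `Φ₂⁻¹ : 𝔻⁴ ≅ W₂`
(`Literature.Topology.FourManifolds.IsBoundaryGluing.transfer`) exhibits `X` as a twisted sphere
`𝔻⁴ ∪_χ 𝔻⁴`, `χ = ∂Φ₂⁻¹ ≫ ψ⁻¹ ≫ ∂Φ₁ ∈ Diff(S³)`, and Cerf concludes.  Contractibility of `W₁`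
enters only through nonemptiness; that of `W₂` is not used (it follows: `W₂ ≅ 𝔻⁴`).
-/

noncomputable section

-- the prescribed namespace `Summit.<P>.<Sub>.…` duplicates `SmoothPoincare4` (P = Sub)
set_option linter.dupNamespace false

open scoped Manifold ContDiff Topology
open Set Function Literature.Topology.FourManifolds Literature.Geometry.Symplectic

namespace Summit.SmoothPoincare4.SmoothPoincare4.Theorems.ContractibleTwistedDoubleStandard.PropertyRMazurHalves

/-! ### A Stein domain whose `J`-convex function is Morse with at most one critical point is a `4`-ball -/

/-- **The minimum of the `J`-convex function of a nonempty Stein domain lies below the maximum**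
(equivalently, is an interior point): otherwise `φ` is constant, so `dφ = 0` at the minimum, which
is then a boundary point (`SteinStructure.boundary_eq`) where `dφ ≠ 0` (`SteinStructure.regular`).
Gompf, *Handlebody construction of Stein surfaces* (1998), §1 (the boundary of a Stein domain is
the regular maximal level set). [folklore] -/
private theorem φ_lt_sSup_of_isMinOn {W : Type*} [TopologicalSpace W]
    [ChartedSpace (EuclideanHalfSpace 4) W] [IsManifold (𝓡∂ 4) ∞ W] [CompactSpace W]
    (S : SteinStructure W) {p : W} (hp : IsMinOn S.φ univ p) :
    S.φ p < sSup (range S.φ) := by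
  by_contra hge
  have hpeq : S.φ p = sSup (range S.φ) := le_antisymm (S.φ_le_sSup p) (not_lt.1 hge)
  have hconst : ∀ y, S.φ y = sSup (range S.φ) := fun y =>
    le_antisymm (S.φ_le_sSup y) (hpeq.ge.trans (hp (mem_univ y)))
  have hpb : (𝓡∂ 4).IsBoundaryPoint p := (S.boundary_eq p).2 hpeq
  refine S.regular p hpb ?_
  have hfun : S.φ = fun _ => sSup (range S.φ) := funext hconst
  rw [hfun]
  exact mfderiv_const

/-- **A compact nonempty Stein domain whose `J`-convex function is Morse with at most one critical
point is diffeomorphic to `𝔻⁴`.**  The minimum `p` of `φ` is an interior point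
(`φ_lt_sSup_of_isMinOn`), hence a critical point (Fermat), hence the only one; the affine
renormalisation `g = φ + (1 - max φ)` is a Morse function adapted to the boundary (`g ≡ 1` and
regular on `∂W = {φ = max φ}`, `g < 1` inside; Milnor 1965, Def. 3.1; affine invariance of the
Morse data, `Literature.Topology.FourManifolds.IsMorse.const_mul_add`) whose only critical point
is the interior local minimum `p`, and Milnor's disc theorem
(`nonempty_diffeomorph_closedBall_of_isMorseAdapted_of_isLocalMin`) gives `W ≅ 𝔻⁴`.
[cite: Milnor1963, Thm. 3.1 and Lemma 2.2] -/
private theorem nonempty_diffeomorph_closedBall_of_subsingleton_criticalSet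
    {W : Type*} [TopologicalSpace W] [T2Space W] [ChartedSpace (EuclideanHalfSpace 4) W]
    [IsManifold (𝓡∂ 4) ∞ W] [CompactSpace W] [Nonempty W] (S : SteinStructure W)
    (hM : IsMorse (𝓡∂ 4) S.φ) (hsub : (criticalSet (𝓡∂ 4) S.φ).Subsingleton) :
    Nonempty (W ≃ₘ⟮𝓡∂ 4, 𝓡∂ 4⟯ Metric.closedBall (0 : EuclideanSpace ℝ (Fin 4)) 1) := by
  -- (1) the minimum is an interior critical point, hence the only critical point
  obtain ⟨p, -, hp⟩ :=
    isCompact_univ.exists_isMinOn univ_nonempty S.φ_smooth.continuous.continuousOn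
  have hpM : S.φ p < sSup (range S.φ) := φ_lt_sSup_of_isMinOn S hp
  have hpi : (𝓡∂ 4).IsInteriorPoint p := (S.isInteriorPoint_iff_φ_lt p).2 hpM
  have hplocal : IsLocalMin S.φ p := hp.isLocalMin Filter.univ_mem
  have hpcrit : IsMCriticalPt (𝓡∂ 4) S.φ p := isMCriticalPt_of_isLocalMin hplocal hpi
  have hdiff : ∀ y, MDifferentiableAt (𝓡∂ 4) 𝓘(ℝ, ℝ) S.φ y := fun y =>
    S.φ_smooth.mdifferentiableAt (by simp)
  -- (2) the adapted Morse function `g = 1 * φ + (1 - max φ)`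
  have hcrit : ∀ y, IsMCriticalPt (𝓡∂ 4) (fun y => 1 * S.φ y + (1 - sSup (range S.φ))) y ↔
      IsMCriticalPt (𝓡∂ 4) S.φ y := fun y =>
    isMCriticalPt_const_mul_add_iff one_ne_zero _ (hdiff y)
  have hg : IsMorseAdapted (𝓡∂ 4) (fun y => 1 * S.φ y + (1 - sSup (range S.φ))) := by
    refine ⟨hM.const_mul_add one_ne_zero _, fun x hx => ?_, fun x hx => ?_⟩
    · have hxb : (𝓡∂ 4).IsBoundaryPoint x := hx
      have hxM : S.φ x = sSup (range S.φ) := (S.boundary_eq x).1 hxb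
      refine ⟨?_, fun hc => S.regular x hxb ((hcrit x).1 hc)⟩
      show 1 * S.φ x + (1 - sSup (range S.φ)) = 1
      rw [hxM]
      ring
    · have hxi : (𝓡∂ 4).IsInteriorPoint x := hx
      have hxM : S.φ x < sSup (range S.φ) := (S.isInteriorPoint_iff_φ_lt x).1 hxi
      show 1 * S.φ x + (1 - sSup (range S.φ)) < 1
      linarith
  have hgmin : IsLocalMin (fun y => 1 * S.φ y + (1 - sSup (range S.φ))) p := by
    refine Filter.Eventually.of_forall fun y => ?_
    have hpy : S.φ p ≤ S.φ y := hp (mem_univ y)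
    show 1 * S.φ p + (1 - sSup (range S.φ)) ≤ 1 * S.φ y + (1 - sSup (range S.φ))
    linarith
  have huniq : ∀ q, IsMCriticalPt (𝓡∂ 4) (fun y => 1 * S.φ y + (1 - sSup (range S.φ))) q →
      q = p := fun q hq => hsub ((hcrit q).1 hq) hpcrit
  exact nonempty_diffeomorph_closedBall_of_isMorseAdapted_of_isLocalMin hg hgmin hpi huniq

/-! ### The stub -/

/-- **Stub `stub_ballHalf` (ball half; conditional on Eliashberg 1990 Thm. 5.1 and Cerf 1968
`Γ₄ = 0`).**  In a Stein bisection `X = e₁(W₁) ∪ e₂(W₂)` of a closed `4`-manifold by two compact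
contractible Stein domains meeting exactly along both boundary images with matched complex
tangencies, if `J₁.φ` is Morse with at most one critical point then `X ≅ S⁴`: `W₁ ≅ 𝔻⁴` by
Milnor's disc theorem (`nonempty_diffeomorph_closedBall_of_subsingleton_criticalSet`); the seam
diffeomorphism `ψ : ∂W₁ ≅ ∂W₂` of the landed stub `stub_seam` and `∂Φ₁ : ∂W₁ ≅ S³`
(`BoundaryData.restrictDiffeomorph`) make `(W₂, J₂)` a Stein filling of `S³`, hence `W₂ ≅ 𝔻⁴`
(hypothesis `Eliashberg1990_steinFilling_sphere_three`); `X = W₁ ∪_ψ W₂` is a boundary gluing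
(pieces `e₁`, `e₂`, seam equations), which transported along `Φ₁⁻¹`, `Φ₂⁻¹`
(`IsBoundaryGluing.transfer`) is a twisted sphere `𝔻⁴ ∪_χ 𝔻⁴`, hence `≅ S⁴` (hypothesis
`cerf_twistedSphere_four`).  Kervaire–Milnor (1963), §1; Cerf (1968); Eliashberg (1990), Thm. 5.1;
Milnor (1963), Thm. 3.1. [folklore] -/
theorem stub_ballHalf :
    Eliashberg1990_steinFilling_sphere_three → cerf_twistedSphere_four →
    ∀ (X : Type) [TopologicalSpace X] [T2Space X] [SecondCountableTopology X] [CompactSpace X]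
      [ChartedSpace (EuclideanSpace ℝ (Fin 4)) X] [IsManifold (𝓡 4) ∞ X]
      (W₁ : Type) [TopologicalSpace W₁] [ChartedSpace (EuclideanHalfSpace 4) W₁]
      [IsManifold (𝓡∂ 4) ∞ W₁] [CompactSpace W₁] [ContractibleSpace W₁]
      (W₂ : Type) [TopologicalSpace W₂] [ChartedSpace (EuclideanHalfSpace 4) W₂]
      [IsManifold (𝓡∂ 4) ∞ W₂] [CompactSpace W₂] [ContractibleSpace W₂]
      (J₁ : SteinStructure W₁) (J₂ : SteinStructure W₂) (e₁ : W₁ → X) (e₂ : W₂ → X),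
      Manifold.IsSmoothEmbedding (𝓡∂ 4) (𝓡 4) ∞ e₁ → Manifold.IsSmoothEmbedding (𝓡∂ 4) (𝓡 4) ∞ e₂ →
      Set.range e₁ ∪ Set.range e₂ = Set.univ →
      Set.range e₁ ∩ Set.range e₂ = e₁ '' (𝓡∂ 4).boundary W₁ →
      Set.range e₁ ∩ Set.range e₂ = e₂ '' (𝓡∂ 4).boundary W₂ →
      (∀ w₁ w₂, e₁ w₁ = e₂ w₂ →
        Submodule.map (mfderiv (𝓡∂ 4) (𝓡 4) e₁ w₁).toLinearMap (contactPlane J₁.J w₁) =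
          Submodule.map (mfderiv (𝓡∂ 4) (𝓡 4) e₂ w₂).toLinearMap (contactPlane J₂.J w₂)) →
      IsMorse (𝓡∂ 4) J₁.φ → (criticalSet (𝓡∂ 4) J₁.φ).Subsingleton →
      Nonempty (X ≃ₘ⟮𝓡 4, 𝓡 4⟯ Metric.sphere (0 : EuclideanSpace ℝ (Fin 5)) 1) := by
  intro hE hCerf X _ _ _ _ _ _ W₁ _ _ _ _ _ W₂ _ _ _ _ _ J₁ J₂ e₁ e₂ h1 h2 hcov hL hR hC hM hsub
  -- the halves are Hausdorff and second countable (embedded in `X`), `W₁` is nonempty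
  haveI : T2Space W₁ := h1.isEmbedding.t2Space
  haveI : T2Space W₂ := h2.isEmbedding.t2Space
  haveI : SecondCountableTopology W₁ := h1.isEmbedding.secondCountableTopology
  haveI : SecondCountableTopology W₂ := h2.isEmbedding.secondCountableTopology
  -- (1)+(2) the first half is a ball
  obtain ⟨Φ₁⟩ := nonempty_diffeomorph_closedBall_of_subsingleton_criticalSet J₁ hM hsub
  -- (3) boundary data, the seam diffeomorphism, and the second half is a ball (Eliashberg)
  obtain ⟨b₁⟩ : Nonempty (BoundaryData (𝓡∂ 4) W₁ (𝓡 3)) := nonempty_boundaryData_holds 3 W₁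
  obtain ⟨b₂⟩ : Nonempty (BoundaryData (𝓡∂ 4) W₂ (𝓡 3)) := nonempty_boundaryData_holds 3 W₂
  obtain ⟨ψ, hψ, -⟩ :=
    LegendrianRKnotRigidity.stub_seam X W₁ W₂ J₁ J₂ e₁ e₂ h1 h2 hL hR hC b₁ b₂
  let D : BoundaryData (𝓡∂ 4) (Metric.closedBall (0 : EuclideanSpace ℝ (Fin 4)) 1) (𝓡 3) :=
    closedBallBoundaryData 3
  obtain ⟨Φ₂⟩ := hE.of_steinStructure J₂ b₂ (ψ.symm.trans (b₁.restrictDiffeomorph D Φ₁))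
  -- (4) `X = W₁ ∪_ψ W₂`
  have hglue : IsBoundaryGluing b₁ b₂ ψ (𝓡 4) X := by
    refine ⟨e₁, e₂, h1, h2, hcov, fun a a' => ⟨fun h => ?_, ?_⟩⟩
    · obtain ⟨hb, -⟩ := Negative.seam_mem_boundary h1 h2 hL hR h
      have ha : a ∈ range b₁.incl := by rw [b₁.range_incl]; exact hb
      obtain ⟨z, rfl⟩ := ha
      refine ⟨z, rfl, h2.isEmbedding.injective ?_⟩
      rw [hψ z]
      exact h.symm
    · rintro ⟨z, rfl, rfl⟩
      exact (hψ z).symm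
  -- (5) transport to the two balls: `X = 𝔻⁴ ∪_χ 𝔻⁴`
  have hT₁ : IsBoundaryGluing D b₂ (ψ ∘ D.restrictDiffeomorph b₁ Φ₁.symm) (𝓡 4) X :=
    IsBoundaryGluing.transfer (b₁ := D) Φ₁.symm hglue
  have hT₁' : IsBoundaryGluing D b₂ ⇑((D.restrictDiffeomorph b₁ Φ₁.symm).trans ψ) (𝓡 4) X := hT₁
  have hT₂ : IsBoundaryGluing D D
      (⇑((D.restrictDiffeomorph b₁ Φ₁.symm).trans ψ).symm ∘ D.restrictDiffeomorph b₂ Φ₂.symm)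
      (𝓡 4) X :=
    IsBoundaryGluing.transfer (b₁ := D) Φ₂.symm hT₁'.symm'
  let χ : (Metric.sphere (0 : EuclideanSpace ℝ (Fin 4)) 1) ≃ₘ⟮𝓡 3, 𝓡 3⟯
      (Metric.sphere (0 : EuclideanSpace ℝ (Fin 4)) 1) :=
    (D.restrictDiffeomorph b₂ Φ₂.symm).trans ((D.restrictDiffeomorph b₁ Φ₁.symm).trans ψ).symm
  have hX : IsTwistedSphere 3 χ X := hT₂
  let T : TwistedSphere 3 χ := { carrier := X, isTwistedSphere := hX }
  exact hCerf χ T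

end Summit.SmoothPoincare4.SmoothPoincare4.Theorems.ContractibleTwistedDoubleStandard.PropertyRMazurHalves

end
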